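import Summits.QuantumFields.YangMills.Theorems.BalabanUVNodesN15TwoSpacingGluingLocalityNear
import HarnessLib

/-!
# N15 = NE2, road (c) — PROGRAMME (PC), towards (PC-B): WALK LOCALITY WITH CLOSE NEAR DATA, II — far parts localized on the INPUT side (the remainder's commutator pieces of FILE 32∕46∕47
# are input-localized) and on the output side, carried as the exponential OUTPUT WEIGHT `e^{−ρ_Zd_Z(y)}` (dag-n15-c g27, n15-c∕290)

Cell `pub-ymgap`, seat `pub-ymgap-dag-n15-c` (generation g27; R134 (a), s1; HUMAN RULING D-0062).  `bears_on: R4∕N15 · K3⁸ SpineGivenEndpointR13SepCoPHV (stmt-QuantumFields-27366)`;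
filed `--kind proof --supports stmt-QuantumFields-27366 --as helper` — COUNT-NEUTRAL.  Pure block-majorant algebra; 0 `def`, 0 `sorry`.  Imports n15-c∕289 `…TwoSpacingGluingLocalityNear`
(`hasMaj_bracket_near`, through it n15-c∕279's kernels).  Nothing in the tree is modified.

WHY.  n15-c∕289 asks two-sided localized remainder pieces; the knits of FILE 32∕46∕47∕52 (hence n15-c∕262's `scGlued`) carry commutator pieces localized on the INPUT side only
(`1_S(y′)`) and defect pieces localized on the OUTPUT side (`1_S(y)`).  A far piece localized on either side still forces every walk of the difference through `Z`; the bookkeeping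
device is the output weight `e^{−ρ_Zd_Z(y)}` for a 1-Lipschitz minorant `d_Z` of the distance to `Z` (`d_Z(y) ≤ d(y,z) + d_Z(z)`, `d_Z ≥ 0`, `d_Z(y) ≤ d(y,z)` for `z ∈ Z`).

WHAT.  §1 kernels: `hasMaj_comp_inLoc` (input localization survives a left factor), `hasMaj_farW_of_inLoc` ∕ `hasMaj_farW_of_outLoc` (`1_Z(y′)` resp. `1_Z(y)` ⟹ weight `e^{−(ρ∕2)d_Z(y)}`
at half the rate ∕ any weight), `hasMaj_farW_comp_exp` (the weight passes a right factor), `hasMaj_comp_farW` (a weight at the intermediate point passes to the output by the Lipschitz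
property).  §2 ★ `hasMaj_bracket_farW` (`D ≤ e^{−ρ_Zd_Z(y)}a₁e^{−δd}`, `E = E_o + E_i`, `E_o ≤ 1_Z(y)θ₁e^{−δd}`, `E_i ≤ 1_Z(y′)θ₂e^{−δd}` ⟹ `D∘N + G₀♭∘N∘E∘N♭ ≤ C·e^{−md_Z(y)}·e^{−ρd}`);
★★★ `hasMaj_glueInv_sub_glueInv_farW` (`G₀ − G₀♭ = D_n + D_f`, `R − R♭ = E_n + E_o + E_i` ⟹ `glueInv G₀ R − glueInv G₀♭ R♭ ≤ [C_n + C_f·e^{−(δ∕4−σ)d_Z(y)}]·e^{−(δ∕4−2σ)d}`, `8σ ≤ δ`).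

HONEST FRAMING ∕ LIMITS.  Algebra of glued inverses; no propagator is estimated; [B9] Cor. 3.8 ∕ Thm 3.14 cited for the MECHANISM only.  NE2⁺ NOT PRINTED, NOT proved; N15 of record
untouched; K3⁸ OPEN; counts UNMOVED.  Restate-immune (no Theses import).
-/

noncomputable section

open scoped BigOperators Matrix
open Finset

namespace Summit.QuantumFields.YangMills.BalabanUVNodes.N15.Gluing

open Literature.MathematicalPhysics.QuantumFieldTheory.Balaban1983to89
open Literature.MathematicalPhysics.QuantumFieldTheory.Balaban1983to89.B11SectG (BlockNorm HasMaj RowSum hasMaj_comp hasMaj_comp_exp conv_exp_le hasMaj_zero)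
open Literature.MathematicalPhysics.QuantumFieldTheory.Balaban1983to89.B6RandomWalk (Triangle254)
open Literature.MathematicalPhysics.QuantumFieldTheory.Balaban1983to89.B6Prop26Gluing (mulOp mulOp_apply ind ind_nonneg ind_le_one ind_of_mem ind_of_not_mem)
open Literature.MathematicalPhysics.QuantumFieldTheory.Balaban1983to89.T4EtaRateCoeffDefect (diagK diagK_nonneg hasMaj_mulOp)

/-! ## §1 Kernels: input localization, the far weight, and compositions -/

section Kernels

variable {g : B6.Geometry} {F₁ F₂ F₃ : Type} [AddCommGroup F₁] [Module ℝ F₁] [AddCommGroup F₂] [Module ℝ F₂] [AddCommGroup F₃] [Module ℝ F₃]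
  (Z : Set g.Site) (dZ : g.Site → ℝ) {σ cr : ℝ}

/-- An INPUT-LOCALIZED right factor keeps its indicator through a composition: `T₁ ≤ a₁e^{−ρ₁d}`, `T₂ ≤ 1_Z(y′)·a₂e^{−ρ₂d}` ⟹ `T₁∘T₂ ≤ 1_Z(y′)·κ₂a₁a₂c_r·e^{−ρd}` (`0 ≤ ρ ≤ ρ₂`,
`ρ + σ ≤ ρ₁`). [folklore] -/
theorem hasMaj_comp_inLoc {b₁ : BlockNorm g F₁} {b₂ : BlockNorm g F₂} {b₃ : BlockNorm g F₃} {T₁ : F₂ →ₗ[ℝ] F₃} {T₂ : F₁ →ₗ[ℝ] F₂} {a₁ a₂ ρ₁ ρ₂ ρ : ℝ}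
    (htri : Triangle254 g) (hd : ∀ a b : g.Site, 0 ≤ g.dist a b) (hrow : RowSum g σ cr) (ha₁ : 0 ≤ a₁) (ha₂ : 0 ≤ a₂) (hρ : 0 ≤ ρ) (hρρ₂ : ρ ≤ ρ₂) (hρρ₁ : ρ + σ ≤ ρ₁)
    (h₁ : HasMaj b₂ b₃ T₁ (fun y z => a₁ * Real.exp (-(ρ₁ * g.dist y z))))
    (h₂ : HasMaj b₁ b₂ T₂ (fun z y' => ind Z y' * (a₂ * Real.exp (-(ρ₂ * g.dist z y'))))) :
    HasMaj b₁ b₃ (T₁ ∘ₗ T₂) (fun y y' => ind Z y' * (b₂.κ * a₁ * a₂ * cr * Real.exp (-(ρ * g.dist y y')))) := by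
  refine (hasMaj_comp h₁ h₂ fun a b => mul_nonneg ha₁ (Real.exp_nonneg _)).mono fun y y' => ?_
  have hconv := conv_exp_le (ρ₁ := ρ₁) (ρ₂ := ρ₂) (ρ := ρ) htri hd hrow hρ hρρ₂ hρρ₁ y y'
  have hc0 : 0 ≤ ind Z y' * (b₂.κ * a₁ * a₂) := by have := b₂.κ_nonneg; have := ind_nonneg Z y'; positivity
  calc ∑ z : g.Site, a₁ * Real.exp (-(ρ₁ * g.dist y z)) * (b₂.κ * (ind Z y' * (a₂ * Real.exp (-(ρ₂ * g.dist z y')))))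
      = ind Z y' * (b₂.κ * a₁ * a₂) * ∑ z : g.Site, Real.exp (-(ρ₁ * g.dist y z)) * Real.exp (-(ρ₂ * g.dist z y')) := by
        rw [Finset.mul_sum]; exact Finset.sum_congr rfl fun z _ => by ring
    _ ≤ ind Z y' * (b₂.κ * a₁ * a₂) * (cr * Real.exp (-(ρ * g.dist y y'))) := mul_le_mul_of_nonneg_left hconv hc0
    _ = _ := by ring

/-- INPUT localization on `Z` ⟹ the far OUTPUT weight at half the rate: `T ≤ 1_Z(y′)·ae^{−ρd}` ⟹ `T ≤ e^{−(ρ∕2)d_Z(y)}·a·e^{−(ρ∕2)d}` (`d_Z(y) ≤ d(y,y′)` for `y′ ∈ Z`). [folklore] -/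
theorem hasMaj_farW_of_inLoc {b₁ : BlockNorm g F₁} {b₂ : BlockNorm g F₂} {T : F₁ →ₗ[ℝ] F₂} {a ρ : ℝ} (hdZ : ∀ y z, z ∈ Z → dZ y ≤ g.dist y z) (ha : 0 ≤ a) (hρ : 0 ≤ ρ)
    (h : HasMaj b₁ b₂ T (fun y y' => ind Z y' * (a * Real.exp (-(ρ * g.dist y y'))))) :
    HasMaj b₁ b₂ T (fun y y' => Real.exp (-(ρ / 2 * dZ y)) * (a * Real.exp (-(ρ / 2 * g.dist y y')))) := by
  refine h.mono fun y y' => ?_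
  by_cases hy : y' ∈ Z
  · rw [ind_of_mem hy, one_mul]
    calc a * Real.exp (-(ρ * g.dist y y')) ≤ a * (Real.exp (-(ρ / 2 * dZ y)) * Real.exp (-(ρ / 2 * g.dist y y'))) :=
          mul_le_mul_of_nonneg_left (exp_far_split Z dZ hdZ hρ y hy) ha
      _ = _ := by ring
  · rw [ind_of_not_mem hy, zero_mul]; positivity

/-- OUTPUT localization on `Z` ⟹ the far output weight with ANY exponent: `T ≤ 1_Z(y)·ae^{−ρd}` ⟹ `T ≤ e^{−cd_Z(y)}·a·e^{−ρd}` (`c ≥ 0`; on `Z`, `d_Z = 0`). [folklore] -/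
theorem hasMaj_farW_of_outLoc {b₁ : BlockNorm g F₁} {b₂ : BlockNorm g F₂} {T : F₁ →ₗ[ℝ] F₂} {a ρ c : ℝ} (hd0 : ∀ y : g.Site, g.dist y y = 0) (hdZ : ∀ y z, z ∈ Z → dZ y ≤ g.dist y z)
    (ha : 0 ≤ a) (hc : 0 ≤ c) (h : HasMaj b₁ b₂ T (fun y y' => ind Z y * (a * Real.exp (-(ρ * g.dist y y'))))) :
    HasMaj b₁ b₂ T (fun y y' => Real.exp (-(c * dZ y)) * (a * Real.exp (-(ρ * g.dist y y')))) :=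
  h.mono fun y _ => mul_le_mul_of_nonneg_right (ind_le_exp_dZ Z dZ hd0 hdZ hc y) (mul_nonneg ha (Real.exp_nonneg _))

/-- The far output weight of a LEFT factor passes a composition: `T₁ ≤ e^{−cd_Z(y)}·a₁e^{−ρ₁d}`, `T₂ ≤ a₂e^{−ρ₂d}` ⟹ `T₁∘T₂ ≤ e^{−cd_Z(y)}·κ₂a₁a₂c_r·e^{−ρd}`. [folklore] -/
theorem hasMaj_farW_comp_exp {b₁ : BlockNorm g F₁} {b₂ : BlockNorm g F₂} {b₃ : BlockNorm g F₃} {T₁ : F₂ →ₗ[ℝ] F₃} {T₂ : F₁ →ₗ[ℝ] F₂} {a₁ a₂ ρ₁ ρ₂ ρ c : ℝ}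
    (htri : Triangle254 g) (hd : ∀ a b : g.Site, 0 ≤ g.dist a b) (hrow : RowSum g σ cr) (ha₁ : 0 ≤ a₁) (ha₂ : 0 ≤ a₂) (hρ : 0 ≤ ρ) (hρρ₂ : ρ ≤ ρ₂) (hρρ₁ : ρ + σ ≤ ρ₁)
    (h₁ : HasMaj b₂ b₃ T₁ (fun y z => Real.exp (-(c * dZ y)) * (a₁ * Real.exp (-(ρ₁ * g.dist y z)))))
    (h₂ : HasMaj b₁ b₂ T₂ (fun z y' => a₂ * Real.exp (-(ρ₂ * g.dist z y')))) :
    HasMaj b₁ b₃ (T₁ ∘ₗ T₂) (fun y y' => Real.exp (-(c * dZ y)) * (b₂.κ * a₁ * a₂ * cr * Real.exp (-(ρ * g.dist y y')))) := by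
  refine (hasMaj_comp h₁ h₂ fun a b => mul_nonneg (Real.exp_nonneg _) (mul_nonneg ha₁ (Real.exp_nonneg _))).mono fun y y' => ?_
  have hconv := conv_exp_le (ρ₁ := ρ₁) (ρ₂ := ρ₂) (ρ := ρ) htri hd hrow hρ hρρ₂ hρρ₁ y y'
  have hc0 : 0 ≤ Real.exp (-(c * dZ y)) * (b₂.κ * a₁ * a₂) := by have := b₂.κ_nonneg; positivity
  calc ∑ z : g.Site, Real.exp (-(c * dZ y)) * (a₁ * Real.exp (-(ρ₁ * g.dist y z))) * (b₂.κ * (a₂ * Real.exp (-(ρ₂ * g.dist z y'))))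
      = Real.exp (-(c * dZ y)) * (b₂.κ * a₁ * a₂) * ∑ z : g.Site, Real.exp (-(ρ₁ * g.dist y z)) * Real.exp (-(ρ₂ * g.dist z y')) := by
        rw [Finset.mul_sum]; exact Finset.sum_congr rfl fun z _ => by ring
    _ ≤ Real.exp (-(c * dZ y)) * (b₂.κ * a₁ * a₂) * (cr * Real.exp (-(ρ * g.dist y y'))) := mul_le_mul_of_nonneg_left hconv hc0
    _ = _ := by ring

/-- A far weight at the INTERMEDIATE point passes to the output by the Lipschitz property of `d_Z`: `T₁ ≤ a₁e^{−ρ₁d}`, `T₂ ≤ e^{−cd_Z(z)}·a₂e^{−ρ₂d}` (weight at `T₂`'s output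
`z`), `0 ≤ m ≤ c`, `d_Z(y) ≤ d(y,z) + d_Z(z)`, `d_Z ≥ 0` ⟹ `T₁∘T₂ ≤ e^{−md_Z(y)}·κ₂a₁a₂c_r·e^{−ρd}` for `0 ≤ ρ ≤ ρ₂`, `ρ + σ + m ≤ ρ₁`. [folklore] -/
theorem hasMaj_comp_farW {b₁ : BlockNorm g F₁} {b₂ : BlockNorm g F₂} {b₃ : BlockNorm g F₃} {T₁ : F₂ →ₗ[ℝ] F₃} {T₂ : F₁ →ₗ[ℝ] F₂} {a₁ a₂ ρ₁ ρ₂ ρ c m : ℝ}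
    (htri : Triangle254 g) (hd : ∀ a b : g.Site, 0 ≤ g.dist a b) (hrow : RowSum g σ cr) (hdZl : ∀ y z, dZ y ≤ g.dist y z + dZ z) (hdZ0 : ∀ y, 0 ≤ dZ y)
    (ha₁ : 0 ≤ a₁) (ha₂ : 0 ≤ a₂) (hm : 0 ≤ m) (hmc : m ≤ c) (hρ : 0 ≤ ρ) (hρρ₂ : ρ ≤ ρ₂) (hρρ₁ : ρ + σ + m ≤ ρ₁)
    (h₁ : HasMaj b₂ b₃ T₁ (fun y z => a₁ * Real.exp (-(ρ₁ * g.dist y z))))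
    (h₂ : HasMaj b₁ b₂ T₂ (fun z y' => Real.exp (-(c * dZ z)) * (a₂ * Real.exp (-(ρ₂ * g.dist z y'))))) :
    HasMaj b₁ b₃ (T₁ ∘ₗ T₂) (fun y y' => Real.exp (-(m * dZ y)) * (b₂.κ * a₁ * a₂ * cr * Real.exp (-(ρ * g.dist y y')))) := by
  refine (hasMaj_comp h₁ h₂ fun a b => mul_nonneg ha₁ (Real.exp_nonneg _)).mono fun y y' => ?_
  have hterm : ∀ z : g.Site, a₁ * Real.exp (-(ρ₁ * g.dist y z)) * (b₂.κ * (Real.exp (-(c * dZ z)) * (a₂ * Real.exp (-(ρ₂ * g.dist z y'))))) ≤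
      Real.exp (-(m * dZ y)) * (b₂.κ * a₁ * a₂) * (Real.exp (-((ρ₁ - m) * g.dist y z)) * Real.exp (-(ρ₂ * g.dist z y'))) := by
    intro z
    have hκ := b₂.κ_nonneg
    have hkey : Real.exp (-(ρ₁ * g.dist y z)) * Real.exp (-(c * dZ z)) ≤ Real.exp (-(m * dZ y)) * Real.exp (-((ρ₁ - m) * g.dist y z)) := by
      rw [← Real.exp_add, ← Real.exp_add]
      refine Real.exp_le_exp.mpr ?_
      have h1 := mul_le_mul_of_nonneg_left (hdZl y z) hm
      have h2 : m * dZ z ≤ c * dZ z := mul_le_mul_of_nonneg_right hmc (hdZ0 z)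
      nlinarith [hd y z, hdZ0 z]
    calc a₁ * Real.exp (-(ρ₁ * g.dist y z)) * (b₂.κ * (Real.exp (-(c * dZ z)) * (a₂ * Real.exp (-(ρ₂ * g.dist z y')))))
        = (b₂.κ * a₁ * a₂ * Real.exp (-(ρ₂ * g.dist z y'))) * (Real.exp (-(ρ₁ * g.dist y z)) * Real.exp (-(c * dZ z))) := by ring
      _ ≤ (b₂.κ * a₁ * a₂ * Real.exp (-(ρ₂ * g.dist z y'))) * (Real.exp (-(m * dZ y)) * Real.exp (-((ρ₁ - m) * g.dist y z))) :=
          mul_le_mul_of_nonneg_left hkey (by positivity)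
      _ = _ := by ring
  have hconv := conv_exp_le (ρ₁ := ρ₁ - m) (ρ₂ := ρ₂) (ρ := ρ) htri hd hrow hρ hρρ₂ (by linarith) y y'
  have hc0 : 0 ≤ Real.exp (-(m * dZ y)) * (b₂.κ * a₁ * a₂) := by have := b₂.κ_nonneg; positivity
  calc ∑ z : g.Site, a₁ * Real.exp (-(ρ₁ * g.dist y z)) * (b₂.κ * (Real.exp (-(c * dZ z)) * (a₂ * Real.exp (-(ρ₂ * g.dist z y')))))
      ≤ ∑ z : g.Site, Real.exp (-(m * dZ y)) * (b₂.κ * a₁ * a₂) * (Real.exp (-((ρ₁ - m) * g.dist y z)) * Real.exp (-(ρ₂ * g.dist z y'))) := Finset.sum_le_sum fun z _ => hterm z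
    _ = Real.exp (-(m * dZ y)) * (b₂.κ * a₁ * a₂) * ∑ z : g.Site, Real.exp (-((ρ₁ - m) * g.dist y z)) * Real.exp (-(ρ₂ * g.dist z y')) := by rw [Finset.mul_sum]
    _ ≤ Real.exp (-(m * dZ y)) * (b₂.κ * a₁ * a₂) * (cr * Real.exp (-(ρ * g.dist y y'))) := mul_le_mul_of_nonneg_left hconv hc0
    _ = _ := by ring

end Kernels

/-! ## §2 The far bracket with output- and input-localized pieces, and the near∕far walk locality -/

section Locality

variable {X : Type} [Fintype X] [DecidableEq X] {g : B6.Geometry} (blk : X → g.Site) (Z : Set g.Site) (dZ : g.Site → ℝ) {σ cr : ℝ}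

/-- ★ **THE FAR BRACKET, WEIGHTED**: `D ≤ e^{−(δ∕2)d_Z(y)}·a₁e^{−(δ∕2)d}` (far weight), `E_o ≤ 1_Z(y)·θ₁e^{−δd}`, `E_i ≤ 1_Z(y′)·θ₂e^{−δd}`, `G₀♭ ≤ Ae^{−δd}`, `R, R♭ ≤ θe^{−δd}`, `θc_r < 1`,
`8σ ≤ δ`, `d_Z ≥ 0` a minorant of the distance to `Z` ⟹ `D∘N + G₀♭∘N∘(E_o + E_i)∘N♭ ≤ (a₁ + A·N_c(θ₁ + θ₂)·c_r)·N_c·e^{−(δ∕4−σ)d_Z(y)}·e^{−(δ∕4−2σ)d}`.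
[cite: Balaban1985BackgroundPropagators, Cor. 3.8 (3.93)–(3.94) p.410 (mechanism)] -/
theorem hasMaj_bracket_farW (htri : Triangle254 g) (hd : ∀ a b : g.Site, 0 ≤ g.dist a b) (hd0 : ∀ y : g.Site, g.dist y y = 0) (hrow : RowSum g σ cr) (hσ : 0 ≤ σ) (hcr : 0 ≤ cr)
    (hdZ : ∀ y z, z ∈ Z → dZ y ≤ g.dist y z) (hdZ0 : ∀ y, 0 ≤ dZ y) {G₀' R R' D Eo Ei : (X → ℝ) →ₗ[ℝ] (X → ℝ)}
    {A θ a₁ θ₁ θ₂ δ : ℝ} (hA : 0 ≤ A) (hθ : 0 ≤ θ) (ha₁ : 0 ≤ a₁) (hθ₁ : 0 ≤ θ₁) (hθ₂ : 0 ≤ θ₂) (hσδ : 8 * σ ≤ δ)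
    (hG₀' : HasMaj (BlockNorm.ofBlocks g blk) (BlockNorm.ofBlocks g blk) G₀' (fun y y' => A * Real.exp (-(δ * g.dist y y'))))
    (hR : HasMaj (BlockNorm.ofBlocks g blk) (BlockNorm.ofBlocks g blk) R (fun y y' => θ * Real.exp (-(δ * g.dist y y'))))
    (hR' : HasMaj (BlockNorm.ofBlocks g blk) (BlockNorm.ofBlocks g blk) R' (fun y y' => θ * Real.exp (-(δ * g.dist y y'))))
    (hD : HasMaj (BlockNorm.ofBlocks g blk) (BlockNorm.ofBlocks g blk) D (fun y y' => Real.exp (-(δ / 2 * dZ y)) * (a₁ * Real.exp (-(δ / 2 * g.dist y y')))))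
    (hEo : HasMaj (BlockNorm.ofBlocks g blk) (BlockNorm.ofBlocks g blk) Eo (fun y y' => ind Z y * (θ₁ * Real.exp (-(δ * g.dist y y')))))
    (hEi : HasMaj (BlockNorm.ofBlocks g blk) (BlockNorm.ofBlocks g blk) Ei (fun y y' => ind Z y' * (θ₂ * Real.exp (-(δ * g.dist y y')))))
    (hq : θ * cr < 1) :
    HasMaj (BlockNorm.ofBlocks g blk) (BlockNorm.ofBlocks g blk) (D ∘ₗ neumannR R + G₀' ∘ₗ neumannR R ∘ₗ (Eo + Ei) ∘ₗ neumannR R')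
      (fun y y' => (a₁ + A * ((1 - θ * cr)⁻¹ * cr) * (θ₁ + θ₂) * cr) * ((1 - θ * cr)⁻¹ * cr) * Real.exp (-((δ / 4 - σ) * dZ y)) *
        Real.exp (-((δ / 4 - 2 * σ) * g.dist y y'))) := by
  have hκ : (BlockNorm.ofBlocks g blk).κ = 1 := rfl
  have hinv : 0 ≤ (1 - θ * cr)⁻¹ := inv_nonneg.2 (by linarith)
  have hN := hasMaj_neumannR blk htri hd hd0 hrow (ρ := δ - σ) hθ (by linarith) (by linarith) hR hq
  have hN' := hasMaj_neumannR blk htri hd hd0 hrow (ρ := δ - σ) hθ (by linarith) (by linarith) hR' hq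
  -- term 1: `D∘N`, the weight passes
  have h1 := hasMaj_farW_comp_exp dZ (b₁ := BlockNorm.ofBlocks g blk) (b₂ := BlockNorm.ofBlocks g blk) (b₃ := BlockNorm.ofBlocks g blk) (T₁ := D) (T₂ := neumannR R)
    (ρ := δ / 2 - σ) htri hd hrow ha₁ hinv (by linarith) (by linarith) (by linarith) hD hN
  -- term 2o: `(G₀♭∘N)∘(E_o∘N♭)`, the first leg into `Z`
  have h2a := hasMaj_comp_exp (b₁ := BlockNorm.ofBlocks g blk) (b₂ := BlockNorm.ofBlocks g blk) (b₃ := BlockNorm.ofBlocks g blk) (T₁ := G₀') (T₂ := neumannR R)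
    (ρ := δ - 2 * σ) htri hd hrow hA hinv (by linarith) (by linarith) (by linarith) hG₀' hN
  have h2b := hasMaj_outLoc_comp_exp Z (ρ₁ := δ) (ρ₂ := δ - σ) (ρ := δ - 2 * σ) htri hd hrow hθ₁ hinv (by linarith) (by linarith) (by linarith) hEo hN'
  have h2o := hasMaj_comp_farOut Z dZ (b₁ := BlockNorm.ofBlocks g blk) (b₂ := BlockNorm.ofBlocks g blk) (b₃ := BlockNorm.ofBlocks g blk) (T₁ := G₀' ∘ₗ neumannR R)
    (T₂ := Eo ∘ₗ neumannR R') (ρ₁ := δ - 2 * σ) (ρ₂ := δ - 2 * σ) (ρ := δ / 2 - 2 * σ) htri hd hrow hdZ (by rw [hκ]; positivity) (by rw [hκ]; positivity) (by linarith)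
    (by linarith) (by linarith) (by linarith) h2a h2b
  -- term 2i: `((G₀♭∘N)∘E_i)∘N♭`, input-localized then weighted
  have h2c := hasMaj_comp_inLoc Z (b₁ := BlockNorm.ofBlocks g blk) (b₂ := BlockNorm.ofBlocks g blk) (b₃ := BlockNorm.ofBlocks g blk) (T₁ := G₀' ∘ₗ neumannR R) (T₂ := Ei)
    (ρ₁ := δ - 2 * σ) (ρ₂ := δ) (ρ := δ - 3 * σ) htri hd hrow (by rw [hκ]; positivity) hθ₂ (by linarith) (by linarith) (by linarith) h2a hEi
  have h2d := hasMaj_farW_of_inLoc Z dZ (b₁ := BlockNorm.ofBlocks g blk) (b₂ := BlockNorm.ofBlocks g blk) hdZ (by rw [hκ]; positivity) (by linarith : (0 : ℝ) ≤ δ - 3 * σ) h2c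
  have h2i := hasMaj_farW_comp_exp dZ (b₁ := BlockNorm.ofBlocks g blk) (b₂ := BlockNorm.ofBlocks g blk) (b₃ := BlockNorm.ofBlocks g blk) (T₁ := (G₀' ∘ₗ neumannR R) ∘ₗ Ei)
    (T₂ := neumannR R') (ρ := δ / 4 - 2 * σ) htri hd hrow (by rw [hκ]; positivity) hinv (by linarith) (by linarith) (by linarith) h2d hN'
  have hsplit : D ∘ₗ neumannR R + G₀' ∘ₗ neumannR R ∘ₗ (Eo + Ei) ∘ₗ neumannR R' =
      D ∘ₗ neumannR R + ((G₀' ∘ₗ neumannR R) ∘ₗ (Eo ∘ₗ neumannR R') + ((G₀' ∘ₗ neumannR R) ∘ₗ Ei) ∘ₗ neumannR R') := by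
    simp only [LinearMap.add_comp, LinearMap.comp_add, LinearMap.comp_assoc]
  rw [hsplit]
  refine (h1.add (h2o.add h2i)).mono fun y y' => ?_
  rw [hκ]
  -- common weight `e^{−(δ∕4−σ)d_Z}` and common rate `δ∕4 − 2σ`
  have hwD : Real.exp (-(δ / 2 * dZ y)) ≤ Real.exp (-((δ / 4 - σ) * dZ y)) := Real.exp_le_exp.mpr (by nlinarith [hdZ0 y])
  have hwO : Real.exp (-((δ - 2 * σ) / 2 * dZ y)) ≤ Real.exp (-((δ / 4 - σ) * dZ y)) := Real.exp_le_exp.mpr (by nlinarith [hdZ0 y])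
  have hwI : Real.exp (-((δ - 3 * σ) / 2 * dZ y)) ≤ Real.exp (-((δ / 4 - σ) * dZ y)) := Real.exp_le_exp.mpr (by nlinarith [hdZ0 y])
  have hrD : Real.exp (-((δ / 2 - σ) * g.dist y y')) ≤ Real.exp (-((δ / 4 - 2 * σ) * g.dist y y')) := Real.exp_le_exp.mpr (by nlinarith [hd y y'])
  have hrO : Real.exp (-((δ / 2 - 2 * σ) * g.dist y y')) ≤ Real.exp (-((δ / 4 - 2 * σ) * g.dist y y')) := Real.exp_le_exp.mpr (by nlinarith [hd y y'])
  have hx0 : 0 ≤ Real.exp (-((δ / 4 - σ) * dZ y)) := Real.exp_nonneg _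
  have hy0 : 0 ≤ Real.exp (-((δ / 4 - 2 * σ) * g.dist y y')) := Real.exp_nonneg _
  have hc1 : 0 ≤ 1 * a₁ * (1 - θ * cr)⁻¹ * cr := by positivity
  have hc2 : 0 ≤ 1 * (1 * A * (1 - θ * cr)⁻¹ * cr) * (1 * θ₁ * (1 - θ * cr)⁻¹ * cr) * cr := by positivity
  have hc3 : 0 ≤ 1 * (1 * (1 * A * (1 - θ * cr)⁻¹ * cr) * θ₂ * cr) * (1 - θ * cr)⁻¹ * cr := by positivity
  calc Real.exp (-(δ / 2 * dZ y)) * (1 * a₁ * (1 - θ * cr)⁻¹ * cr * Real.exp (-((δ / 2 - σ) * g.dist y y'))) +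
        (1 * (1 * A * (1 - θ * cr)⁻¹ * cr) * (1 * θ₁ * (1 - θ * cr)⁻¹ * cr) * cr * Real.exp (-((δ - 2 * σ) / 2 * dZ y)) * Real.exp (-((δ / 2 - 2 * σ) * g.dist y y')) +
          Real.exp (-((δ - 3 * σ) / 2 * dZ y)) * (1 * (1 * (1 * A * (1 - θ * cr)⁻¹ * cr) * θ₂ * cr) * (1 - θ * cr)⁻¹ * cr * Real.exp (-((δ / 4 - 2 * σ) * g.dist y y'))))
      ≤ Real.exp (-((δ / 4 - σ) * dZ y)) * (1 * a₁ * (1 - θ * cr)⁻¹ * cr * Real.exp (-((δ / 4 - 2 * σ) * g.dist y y'))) +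
        (1 * (1 * A * (1 - θ * cr)⁻¹ * cr) * (1 * θ₁ * (1 - θ * cr)⁻¹ * cr) * cr * Real.exp (-((δ / 4 - σ) * dZ y)) * Real.exp (-((δ / 4 - 2 * σ) * g.dist y y')) +
          Real.exp (-((δ / 4 - σ) * dZ y)) * (1 * (1 * (1 * A * (1 - θ * cr)⁻¹ * cr) * θ₂ * cr) * (1 - θ * cr)⁻¹ * cr * Real.exp (-((δ / 4 - 2 * σ) * g.dist y y')))) := by
        gcongr
    _ = _ := by ring

/-- ★★★ **WALK LOCALITY WITH CLOSE NEAR DATA, FAR PARTS ON EITHER SIDE**: `G₀♭ ≤ Ae^{−δd}`, `R, R♭ ≤ θe^{−δd}`, `θc_r < 1`, `8σ ≤ δ`; `G₀ − G₀♭ = D_n + D_f`, `R − R♭ = E_n + E_o + E_i`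
with SMALL near parts `D_n ≤ ε₁e^{−δd}`, `E_n ≤ θ_ne^{−δd}`, a far-weighted `D_f ≤ e^{−(δ∕2)d_Z(y)}a₁e^{−(δ∕2)d}`, an output-localized `E_o ≤ 1_Z(y)θ₁e^{−δd}` and an input-localized
`E_i ≤ 1_Z(y′)θ₂e^{−δd}` ⟹ `glueInv G₀ R − glueInv G₀♭ R♭ ≤ [(ε₁ + AN_cθ_nc_r)N_c + (a₁ + AN_c(θ₁+θ₂)c_r)N_c·e^{−(δ∕4−σ)d_Z(y)}]·e^{−(δ∕4−2σ)d}`.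
[cite: Balaban1985BackgroundPropagators, Cor. 3.8 (3.93)–(3.94) p.410, Thm 3.14 pp.426–427 (mechanism); Balaban1984PropagatorsII, (2.91) p.239, (2.135)–(2.136) p.247] -/
theorem hasMaj_glueInv_sub_glueInv_farW (htri : Triangle254 g) (hd : ∀ a b : g.Site, 0 ≤ g.dist a b) (hd0 : ∀ y : g.Site, g.dist y y = 0) (hrow : RowSum g σ cr) (hσ : 0 ≤ σ)
    (hcr : 0 ≤ cr) (hdZ : ∀ y z, z ∈ Z → dZ y ≤ g.dist y z) (hdZ0 : ∀ y, 0 ≤ dZ y)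
    {G₀ G₀' R R' Dn Df En Eo Ei : (X → ℝ) →ₗ[ℝ] (X → ℝ)} {A θ ε₁ θn a₁ θ₁ θ₂ δ : ℝ} (hA : 0 ≤ A) (hθ : 0 ≤ θ) (hε₁ : 0 ≤ ε₁) (hθn : 0 ≤ θn) (ha₁ : 0 ≤ a₁)
    (hθ₁ : 0 ≤ θ₁) (hθ₂ : 0 ≤ θ₂) (hσδ : 8 * σ ≤ δ) (hG : G₀ - G₀' = Dn + Df) (hRR : R - R' = En + (Eo + Ei))
    (hG₀' : HasMaj (BlockNorm.ofBlocks g blk) (BlockNorm.ofBlocks g blk) G₀' (fun y y' => A * Real.exp (-(δ * g.dist y y'))))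
    (hR : HasMaj (BlockNorm.ofBlocks g blk) (BlockNorm.ofBlocks g blk) R (fun y y' => θ * Real.exp (-(δ * g.dist y y'))))
    (hR' : HasMaj (BlockNorm.ofBlocks g blk) (BlockNorm.ofBlocks g blk) R' (fun y y' => θ * Real.exp (-(δ * g.dist y y'))))
    (hDn : HasMaj (BlockNorm.ofBlocks g blk) (BlockNorm.ofBlocks g blk) Dn (fun y y' => ε₁ * Real.exp (-(δ * g.dist y y'))))
    (hEn : HasMaj (BlockNorm.ofBlocks g blk) (BlockNorm.ofBlocks g blk) En (fun y y' => θn * Real.exp (-(δ * g.dist y y'))))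
    (hDf : HasMaj (BlockNorm.ofBlocks g blk) (BlockNorm.ofBlocks g blk) Df (fun y y' => Real.exp (-(δ / 2 * dZ y)) * (a₁ * Real.exp (-(δ / 2 * g.dist y y')))))
    (hEo : HasMaj (BlockNorm.ofBlocks g blk) (BlockNorm.ofBlocks g blk) Eo (fun y y' => ind Z y * (θ₁ * Real.exp (-(δ * g.dist y y')))))
    (hEi : HasMaj (BlockNorm.ofBlocks g blk) (BlockNorm.ofBlocks g blk) Ei (fun y y' => ind Z y' * (θ₂ * Real.exp (-(δ * g.dist y y')))))
    (hq : θ * cr < 1) :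
    HasMaj (BlockNorm.ofBlocks g blk) (BlockNorm.ofBlocks g blk) (glueInv G₀ R - glueInv G₀' R')
      (fun y y' => ((ε₁ + A * ((1 - θ * cr)⁻¹ * cr) * θn * cr) * ((1 - θ * cr)⁻¹ * cr) +
          (a₁ + A * ((1 - θ * cr)⁻¹ * cr) * (θ₁ + θ₂) * cr) * ((1 - θ * cr)⁻¹ * cr) * Real.exp (-((δ / 4 - σ) * dZ y))) *
        Real.exp (-((δ / 4 - 2 * σ) * g.dist y y'))) := by
  have hσδ' : σ ≤ δ := by linarith
  have hunit := isUnit_neumannR blk hd hrow hθ hσδ' hR hq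
  have hunit' := isUnit_neumannR blk hd hrow hθ hσδ' hR' hq
  have hsplit : glueInv G₀ R - glueInv G₀' R' =
      (Dn ∘ₗ neumannR R + G₀' ∘ₗ neumannR R ∘ₗ En ∘ₗ neumannR R') + (Df ∘ₗ neumannR R + G₀' ∘ₗ neumannR R ∘ₗ (Eo + Ei) ∘ₗ neumannR R') := by
    rw [glueInv_sub_glueInv hunit hunit', hG, hRR]
    simp only [LinearMap.add_comp, LinearMap.comp_add]
    abel
  have hn := hasMaj_bracket_near blk htri hd hd0 hrow hσ hcr hA hθ hε₁ hθn (by linarith) hG₀' hR hR' hDn hEn hq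
  have hf := hasMaj_bracket_farW blk Z dZ htri hd hd0 hrow hσ hcr hdZ hdZ0 hA hθ ha₁ hθ₁ hθ₂ hσδ hG₀' hR hR' hDf hEo hEi hq
  rw [hsplit]
  refine (hn.add hf).mono fun y y' => ?_
  have hE1 : Real.exp (-((δ - 3 * σ) * g.dist y y')) ≤ Real.exp (-((δ / 4 - 2 * σ) * g.dist y y')) := Real.exp_le_exp.mpr (by nlinarith [hd y y'])
  have hinv : 0 ≤ (1 - θ * cr)⁻¹ := inv_nonneg.2 (by linarith)
  have hc1 : 0 ≤ (ε₁ + A * ((1 - θ * cr)⁻¹ * cr) * θn * cr) * ((1 - θ * cr)⁻¹ * cr) := by positivity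
  calc (ε₁ + A * ((1 - θ * cr)⁻¹ * cr) * θn * cr) * ((1 - θ * cr)⁻¹ * cr) * Real.exp (-((δ - 3 * σ) * g.dist y y')) +
        (a₁ + A * ((1 - θ * cr)⁻¹ * cr) * (θ₁ + θ₂) * cr) * ((1 - θ * cr)⁻¹ * cr) * Real.exp (-((δ / 4 - σ) * dZ y)) * Real.exp (-((δ / 4 - 2 * σ) * g.dist y y'))
      ≤ (ε₁ + A * ((1 - θ * cr)⁻¹ * cr) * θn * cr) * ((1 - θ * cr)⁻¹ * cr) * Real.exp (-((δ / 4 - 2 * σ) * g.dist y y')) +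
        (a₁ + A * ((1 - θ * cr)⁻¹ * cr) * (θ₁ + θ₂) * cr) * ((1 - θ * cr)⁻¹ * cr) * Real.exp (-((δ / 4 - σ) * dZ y)) * Real.exp (-((δ / 4 - 2 * σ) * g.dist y y')) := by
        gcongr
    _ = _ := by ring

end Locality

end Summit.QuantumFields.YangMills.BalabanUVNodes.N15.Gluing

end
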